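import Summits.Langlands.Langlands.Theorems.FrobeniusUnitCarving
import Summits.Langlands.Langlands.Theses.FrobeniusUnitCarving
import Literature.NumberTheory.GaloisRepresentations.ArtinRestriction
import Literature.NumberTheory.GaloisRepresentations.ResidualPairIntegrality
import HarnessLib

/-!
# FU descends along finite extensions: POTENTIAL unit Frobenius ⟹ unit Frobenius (all ranks)

decomp-langlands lens-6 («barrier-complement carving»), generation 35 — second kernel edge for the deciding
crux FU = `Summit.Langlands.Langlands.Theses.FrobeniusUnitCarving.FrobeniusUnits` (stmt-Langlands-27434) of
the OPEN route `FrobeniusUnitCarving`.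

**The edge (unconditional, every rank `n`).**  If `ρ : Γ_K → GL_n(ℚ̄_ℓ)` is unramified almost everywhere and
its restriction `ρ|_{Γ_E}` to a finite extension `E/K` HAS UNIT FROBENIUS AVATARS
(`HasUnitFrobenius E ℓ ι (ρ.restrictField E)`), then so does `ρ` (`hasUnitFrobenius_of_restrictField`).
Mechanism: at an unramified `v` below a good place `w` of `E`, `ρ|_E(Frob_w) = ρ(Frob_v)^{f(w|v)}`
(`FramedGaloisRep.exists_restrictField_apply_eq_pow`), so every Frobenius eigenvalue `β` at `v` has
`β^{f}` among the Frobenius eigenvalues at `w` (spectral mapping, `pow_mem_roots_charpoly_pow`); a complex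
number whose `f`-th power (`f ≥ 1`) has absolute value `1` has absolute value `1`.  The finitely many bad
`w` shadow finitely many `v` (`w ↦ w ∩ 𝓞_K`), and every `v` has some `w` above it.

**Why it matters for FU.**  This is the transfer that turns POTENTIAL automorphy into the FU conclusion over
`K` itself: on the potentially-automorphic sector (`ρ|_{Γ_E}` automorphic for some finite, e.g. solvable /
CM, `E/K` — Taylor 2002/2006, HSBT 2010, BLGGT 2014 for regular (polarised) `ρ`), local–global compatibility
gives `HasUnitFrobenius` for `ρ|_{Γ_E}` (g33 kernel `norm_symm_inv_eq_one_of_automorphicToGalois` /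
`hasUnitFrobenius_of_compatibleFamily` upstairs) and this file descends it to `ρ` — with NO descent of
automorphy (which is exactly what is not known).  So the `stub_higherRank` / `stub_rankTwo` sectors of the
registered skeleton need FU only POTENTIALLY (`frobeniusUnits_of_potentially`).

Contents: §1 two elementary lemmas (spectral mapping for `charpoly (M^f)`; a place above); §2 the descent
theorem; §3 the crux-level corollary `frobeniusUnits_of_potentially` (FU follows from "every irreducible geometric `ρ`
acquires unit Frobenius avatars over SOME finite extension of `K`").
-/

set_option linter.dupNamespace false -- project-wide option (lakefile weak.linter.dupNamespace); `Summit.Langlands.Langlands` is the mandated namespace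

open scoped NumberField Polynomial MatrixGroups Matrix
open Filter IsDedekindDomain Field Polynomial NumberField
open Literature.NumberTheory.GaloisRepresentations
open Summit.Langlands.Langlands.Theorems.FrobeniusUnitCarving (HasUnitFrobenius)

namespace Summit.Langlands.Langlands.Theorems.FrobeniusUnitCarvingDescent

/-! ## §1. Elementary lemmas -/

/-- **spectral mapping for characteristic polynomials**: over a field, if `β` is a root of `charpoly M` then `β ^ f` is a
root of `charpoly (M ^ f)` (`Matrix.mem_spectrum_iff_isRoot_charpoly`, `spectrum.pow_mem_pow`). [folklore] -/
theorem pow_mem_roots_charpoly_pow {k : Type*} [Field k] {d : ℕ} (M : Matrix (Fin d) (Fin d) k) (f : ℕ) {β : k}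
    (hβ : β ∈ M.charpoly.roots) : β ^ f ∈ (M ^ f).charpoly.roots := by
  classical
  rcases Nat.eq_zero_or_pos d with hd0 | hdpos
  · exfalso
    subst hd0
    have h1 : M.charpoly = 1 := by unfold Matrix.charpoly; exact Matrix.det_isEmpty
    rw [h1, Polynomial.roots_one] at hβ
    exact Multiset.notMem_zero _ hβ
  haveI : Nonempty (Fin d) := ⟨⟨0, hdpos⟩⟩
  have hspec : β ∈ spectrum k M := Matrix.mem_spectrum_of_isRoot_charpoly (Polynomial.isRoot_of_mem_roots hβ)
  have hspecf : β ^ f ∈ spectrum k (M ^ f) := spectrum.pow_mem_pow M f hspec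
  exact (Polynomial.mem_roots (M ^ f).charpoly_monic.ne_zero).mpr (Matrix.mem_spectrum_iff_isRoot_charpoly.mp hspecf)

variable {K : Type} [Field K] [NumberField K]

/-- every finite place of `K` lies below some finite place of a finite extension `E`
(Mathlib `Ideal.exists_maximal_ideal_liesOver_of_isIntegral`). [folklore] -/
theorem exists_under_eq (E : Type) [Field E] [NumberField E] [Algebra K E] (v : HeightOneSpectrum (𝓞 K)) :
    ∃ w : HeightOneSpectrum (𝓞 E), w.under (𝓞 K) = v := by
  haveI := v.isMaximal
  obtain ⟨Q, hQ, hQv⟩ := Ideal.exists_maximal_ideal_liesOver_of_isIntegral (S := 𝓞 E) v.asIdeal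
  have hQ0 : Q ≠ ⊥ := fun h => by
    rw [h] at hQv
    exact v.ne_bot (by rw [hQv.over, Ideal.under_bot])
  exact ⟨⟨Q, hQ.isPrime, hQ0⟩, HeightOneSpectrum.ext hQv.over.symm⟩

omit [NumberField K] in
/-- a rational prime in a place upstairs is in the place downstairs. [folklore] -/
theorem natCast_mem_under {E : Type} [Field E] [NumberField E] [Algebra K E] (w : HeightOneSpectrum (𝓞 E)) {m : ℕ}
    (h : ((m : ℕ) : 𝓞 E) ∈ w.asIdeal) : ((m : ℕ) : 𝓞 K) ∈ (w.under (𝓞 K)).asIdeal := by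
  rw [HeightOneSpectrum.under_asIdeal, Ideal.under_def, Ideal.mem_comap, map_natCast]
  exact h

/-! ## §2. The descent theorem -/

variable {ℓ : ℕ} [Fact ℓ.Prime] {n : ℕ}

/-- **DESCENT OF UNIT FROBENIUS AVATARS (potential ⟹ actual; unconditional, all ranks).**  If `ρ` is unramified
almost everywhere and `ρ|_{Γ_E}` has unit Frobenius avatars for a finite extension `E/K`, then `ρ` has unit Frobenius
avatars: `ρ|_E(Frob_w) = ρ(Frob_v)^{f(w|v)}` puts `β^{f(w|v)}` among the eigenvalues at `w` for every eigenvalue `β`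
at `v`, and `|z|^f = 1, f ≥ 1 ⟹ |z| = 1`.  Serre 1968 Ch. I §2.1 (restriction and Frobenii); the eigenvalue
bookkeeping is `pow_mem_roots_charpoly_pow`. [new] (node-local statement) -/
theorem hasUnitFrobenius_of_restrictField (E : Type) [Field E] [NumberField E] [Algebra K E]
    (ι : PadicAlgCl ℓ ≃+* ℂ) (ρ : FramedGaloisRep K (PadicAlgCl ℓ) n)
    (hunr : ∀ᶠ v : HeightOneSpectrum (𝓞 K) in cofinite, ρ.IsUnramifiedAt v)
    (hE : HasUnitFrobenius E ℓ ι (ρ.restrictField E)) : HasUnitFrobenius K ℓ ι ρ := by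
  classical
  -- the finitely many bad places of `E` and their finitely many shadows in `K`
  have hT := Filter.eventually_cofinite.mp hE
  have hS := (hT.image fun w : HeightOneSpectrum (𝓞 E) => w.under (𝓞 K)).compl_mem_cofinite
  filter_upwards [hunr, hS] with v hv hvS P hP β hβ ℓ' _ ι' hvℓ'
  -- a place `w ∣ v`; it is good, and `ℓ' ∉ w`
  obtain ⟨w, hw⟩ := exists_under_eq E v
  have hwgood : ∀ P : Polynomial (PadicAlgCl ℓ), (ρ.restrictField E).HasFrobCharpolyAt w P → ∀ β ∈ P.roots,
      ∀ (ℓ' : ℕ) [Fact ℓ'.Prime] (ι' : PadicAlgCl ℓ' ≃+* ℂ), ((ℓ' : ℕ) : 𝓞 E) ∉ w.asIdeal → ‖ι'.symm (ι β)‖ = 1 := by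
    by_contra hbad
    exact hvS ⟨w, hbad, hw⟩
  have hwv : w.asIdeal.under (𝓞 K) = v.asIdeal := by rw [← hw]; rfl
  have hwℓ' : ((ℓ' : ℕ) : 𝓞 E) ∉ w.asIdeal := fun h => hvℓ' (hw ▸ natCast_mem_under w h)
  -- Frobenius upstairs is a power of Frobenius downstairs
  obtain ⟨𝔔, h𝔔⟩ := w.primesAbove_nonempty
  obtain ⟨τ, hτ⟩ := HeightOneSpectrum.exists_isArithFrobAt_of_mem_primesAbove_holds h𝔔
  obtain ⟨𝔓, h𝔓, φ, hφ, heq⟩ := ρ.exists_restrictField_apply_eq_pow hwv hv h𝔔 hτ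
  have hPφ : FramedRep.charpoly ρ φ = P := hP 𝔓 h𝔓 φ hφ
  -- the Frobenius polynomial at `w` and `β ^ f` among its roots
  have hPw : (ρ.restrictField E).HasFrobCharpolyAt w (FramedRep.charpoly (ρ.restrictField E) τ) :=
    (ρ.isUnramifiedAt_restrictField (E := E) hwv hv).hasFrobCharpolyAt_charpoly h𝔔 hτ
  set f : ℕ := w.asIdeal.inertiaDeg (𝓞 K) with hf_def
  have hβf : β ^ f ∈ (FramedRep.charpoly (ρ.restrictField E) τ).roots := by
    have hβ' : β ∈ (((ρ φ : GL (Fin n) (PadicAlgCl ℓ)) : Matrix (Fin n) (Fin n) (PadicAlgCl ℓ))).charpoly.roots := by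
      rw [← hPφ] at hβ; exact hβ
    have := pow_mem_roots_charpoly_pow _ f hβ'
    unfold FramedRep.charpoly
    rw [heq, Units.val_pow_eq_pow_val]
    exact this
  -- conclude: `‖ι'⁻¹ ι (β ^ f)‖ = 1`, `f ≥ 1`
  have h1 : ‖ι'.symm (ι (β ^ f))‖ = 1 := hwgood _ hPw (β ^ f) hβf ℓ' ι' hwℓ'
  rw [map_pow, map_pow, norm_pow] at h1
  have hf : f ≠ 0 := (Ideal.inertiaDeg_pos w.asIdeal (𝓞 K)).ne'
  exact (pow_eq_one_iff_of_nonneg (norm_nonneg _) hf).mp h1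

/-! ## §3. Crux-level corollary: FU follows from its POTENTIAL form -/

/-- **FU ⟸ POTENTIAL FU.**  If every irreducible geometric `ρ : Γ_K → GL_n(ℚ̄_ℓ)` acquires unit Frobenius avatars over SOME
finite extension `E/K` (the form in which potential automorphy + local–global compatibility deliver it: Taylor 2002/2006,
HSBT 2010, BLGGT 2014 on the regular polarised sector), then FU holds — by the descent theorem, with no descent of
automorphy.  (The converse is trivial with `E = K`; it is not recorded, to keep this file free of definitions.) -/
theorem frobeniusUnits_of_potentially
    (h : ∀ (K : Type) [Field K] [NumberField K] (n : ℕ), 0 < n → ∀ (ℓ : ℕ) [Fact ℓ.Prime] (ι : PadicAlgCl ℓ ≃+* ℂ)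
      (ρ : FramedGaloisRep K (PadicAlgCl ℓ) n), ρ.toGaloisRep.IsIrreducible →
      ((∀ᶠ v : HeightOneSpectrum (𝓞 K) in cofinite, ρ.IsUnramifiedAt v) ∧
        ∀ (v : HeightOneSpectrum (𝓞 K)) (hv : ((ℓ : ℕ) : 𝓞 K) ∈ v.asIdeal),
          (Literature.NumberTheory.PAdicHodge.fontainePstAdicCompletion v ℓ hv).IsDeRhamFramed (ρ.toLocal v)) →
      ∃ (E : Type) (_ : Field E) (_ : NumberField E) (_ : Algebra K E), HasUnitFrobenius E ℓ ι (ρ.restrictField E)) :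
    Summit.Langlands.Langlands.Theses.FrobeniusUnitCarving.FrobeniusUnits := by
  intro K _ _ n hn ℓ _ ι ρ hirr hgeo
  obtain ⟨E, _, _, _, hE⟩ := h K n hn ℓ ι ρ hirr hgeo
  exact hasUnitFrobenius_of_restrictField E ι ρ hgeo.1 hE

end Summit.Langlands.Langlands.Theorems.FrobeniusUnitCarvingDescent
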